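import Literature.InformationTheory.StateDiscrimination.PureStateHelstromBound
import Mathlib.Algebra.Order.Ring.Pow
import HarnessLib

/-!
# Discriminating `N` copies of two pure states: overlap powers and the copy lower bound

For product (tensor-power) states the overlaps multiply, `⟨ψ^{⊗N}|φ^{⊗N}⟩ = ⟨ψ|φ⟩^N`, so the
pure-state Helstrom bound (Barnett 2009 §4.4 eqs. (4.55)–(4.58), in the tree as
`PureStateHelstromBound`) applied to `N` copies reads: any measurement that identifies which of
`ψ^{⊗N}`, `φ^{⊗N}` it holds with error `≤ ε` on both must have `|⟨ψ|φ⟩|^{2N} ≤ 4ε(1 − ε)`, i.e.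
(Bernoulli) at least `N ≥ (1 − 4ε(1 − ε)) / (1 − |⟨ψ|φ⟩|²)` copies are consumed — the generic
"sample complexity of distinguishing close states" step behind copy lower bounds such as
Cotler–Huang–McClean 2021 §3 Prop. 2 (in the tree as the barrier `SQVersusStateInputSeparation`,
which uses its own product-state bookkeeping).  This file states that step once, in general:

* `tensorPower ψ N : (Fin N → X) → ℂ`, `(ψ^{⊗N})(i) = ∏_t ψ(i t)`; `star_tensorPower_dotProduct`
  (`⟨ψ^{⊗N}|φ^{⊗N}⟩ = ⟨ψ|φ⟩^N`), `tensorPower_normSq` (unit stays unit);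
* `copies_overlap_pow_le` (`|⟨ψ|φ⟩|^{2N} ≤ 4ε(1 − ε)`) and `copies_lower_bound`
  (`N · (1 − |⟨ψ|φ⟩|²) ≥ 1 − 4ε(1 − ε)`).

## References
* [Barnett2009] S. Barnett, *Quantum Information*, OUP 2009, §4.4 eqs. (4.55)–(4.58).
* [CotlerHuangMcclean2021] J. Cotler, H.-Y. Huang, J. R. McClean, arXiv:2112.00811, §3 proof of
  Prop. 2 (the `N`-copy overlap argument).
* [NielsenChuang2010] Nielsen–Chuang §9.2 (trace distance and distinguishability).
-/

noncomputable section

open scoped BigOperators ComplexOrder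
open Matrix Finset

namespace Literature.InformationTheory.StateDiscrimination

namespace TensorPowerDiscrimination

open Literature.Computability.Cryptography.Chen2024

variable {X : Type*} [Fintype X] [DecidableEq X]

/-- The `N`-th tensor power of an amplitude vector: `(ψ^{⊗N})(i) = ∏_t ψ(i_t)` on the index set
`Fin N → X`. [cite: CotlerHuangMcclean2021, §3 proof of Prop. 2 (`|x⟩^{⊗N}`)] -/
def tensorPower (ψ : X → ℂ) (N : ℕ) : (Fin N → X) → ℂ := fun i => ∏ t, ψ (i t)

omit [DecidableEq X] in
/-- Overlaps of tensor powers are powers of the overlap: `⟨ψ^{⊗N}|φ^{⊗N}⟩ = ⟨ψ|φ⟩^N`.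
[cite: CotlerHuangMcclean2021, §3 proof of Prop. 2]; [cite: NielsenChuang2010, §9.2] -/
theorem star_tensorPower_dotProduct (ψ φ : X → ℂ) (N : ℕ) :
    star (tensorPower ψ N) ⬝ᵥ tensorPower φ N = (star ψ ⬝ᵥ φ) ^ N := by
  unfold tensorPower dotProduct
  simp only [Pi.star_apply, star_prod, ← prod_mul_distrib]
  rw [show (∑ x, star (ψ x) * φ x) ^ N = ∏ _t : Fin N, ∑ x, star (ψ x) * φ x by
      rw [Finset.prod_const, Finset.card_univ, Fintype.card_fin],
    Finset.prod_univ_sum (fun _ => (univ : Finset X)) (fun t j => star (ψ j) * φ j),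
    Fintype.piFinset_univ]

omit [DecidableEq X] in
/-- A unit vector has unit tensor powers. [cite: NielsenChuang2010, §9.2] -/
theorem tensorPower_normSq {ψ : X → ℂ} (hψ : star ψ ⬝ᵥ ψ = 1) (N : ℕ) :
    star (tensorPower ψ N) ⬝ᵥ tensorPower ψ N = 1 := by
  rw [star_tensorPower_dotProduct, hψ, one_pow]

variable {κ : Type*} [Fintype κ]

/-- **`N`-copy Helstrom step.**  If a measurement on `N` copies names `ψ` (outcome `k`) with
probability `≥ 1 − ε` on `ψ^{⊗N}` and a different outcome `k'` with probability `≥ 1 − ε` on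
`φ^{⊗N}` (`ε ≤ 1/2`, unit `ψ, φ`), then `|⟨ψ|φ⟩|^{2N} ≤ 4ε(1 − ε)`.
[cite: Barnett2009, §4.4 eqs. (4.55)–(4.58)]; [cite: CotlerHuangMcclean2021, §3 proof of Prop. 2] -/
theorem copies_overlap_pow_le [DecidableEq κ] {N : ℕ} (F : POVM (Fin N → X) κ) {ε : ℝ}
    (hε : ε ≤ 1 / 2) {ψ φ : X → ℂ} (hψ : star ψ ⬝ᵥ ψ = 1) (hφ : star φ ⬝ᵥ φ = 1) {k k' : κ}
    (hk : F.AlmostCertain ε (tensorPower ψ N) k) (hk' : F.AlmostCertain ε (tensorPower φ N) k')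
    (hkk : k ≠ k') :
    (‖star ψ ⬝ᵥ φ‖ ^ 2) ^ N ≤ 4 * ε * (1 - ε) := by
  have h := PureStateHelstromBound.povm_norm_sq_dotProduct_le_helstrom F hε
    (tensorPower_normSq hψ N) (tensorPower_normSq hφ N) hk hk' hkk
  rwa [star_tensorPower_dotProduct, norm_pow, ← pow_mul, mul_comm N 2, pow_mul] at h

/-- **Copy lower bound.**  Under the hypotheses of `copies_overlap_pow_le`:
`N · (1 − |⟨ψ|φ⟩|²) ≥ 1 − 4ε(1 − ε)` (Bernoulli: `1 − N(1 − g) ≤ g^N` for `g = |⟨ψ|φ⟩|² ∈ [0,1]`),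
so distinguishing states of overlap `|⟨ψ|φ⟩|² = 1 − η` with constant error costs `Ω(1/η)` copies.
[cite: CotlerHuangMcclean2021, §3 Prop. 2 ("requires Ω(2ⁿ)" from overlap `1 − 2/d` per copy)];
[cite: Barnett2009, §4.4 eqs. (4.55)–(4.58)] -/
theorem copies_lower_bound [DecidableEq κ] {N : ℕ} (F : POVM (Fin N → X) κ) {ε : ℝ}
    (hε : ε ≤ 1 / 2) {ψ φ : X → ℂ} (hψ : star ψ ⬝ᵥ ψ = 1) (hφ : star φ ⬝ᵥ φ = 1) {k k' : κ}
    (hk : F.AlmostCertain ε (tensorPower ψ N) k) (hk' : F.AlmostCertain ε (tensorPower φ N) k')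
    (hkk : k ≠ k') :
    1 - 4 * ε * (1 - ε) ≤ N * (1 - ‖star ψ ⬝ᵥ φ‖ ^ 2) := by
  have hle := copies_overlap_pow_le F hε hψ hφ hk hk' hkk
  set g : ℝ := ‖star ψ ⬝ᵥ φ‖ ^ 2 with hg
  have hg1 : g ≤ 1 := by
    have h := norm_sq_star_dotProduct_le ψ φ
    rw [hψ, hφ, Complex.one_re, mul_one] at h
    exact h
  -- Bernoulli: `1 + N·(g − 1) ≤ (1 + (g − 1))^N = g^N`
  have hB := one_add_mul_le_pow (show (-2 : ℝ) ≤ g - 1 by have := sq_nonneg ‖star ψ ⬝ᵥ φ‖; linarith) N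
  rw [add_sub_cancel] at hB
  have : 1 + (N : ℝ) * (g - 1) ≤ 4 * ε * (1 - ε) := hB.trans hle
  linarith

end TensorPowerDiscrimination

end Literature.InformationTheory.StateDiscrimination

end
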